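import Mathlib
import Summits.Ventures.HodgeRepro2.T5DeltaTwistSymplectic

/-!
# T5DeltaTwistTensor — the δ-twist identity on the WHOLE tensor space (Tier-5 N2 / §G support)

Kernel witness behind the one-line [A] of route/T5-N2-route-3.md §N2.9.2 (l. 63, on the record):
«the δ-twist of HKS §0 / T4N — the symplectic space tr_{E/F}(δ⁻¹⟨·,·⟩ ⊗ δ(·,·)) = tr_{E/F}(⟨·,·⟩ ⊗ (·,·))
is the datum's» — and the register note of §N2.25 (l. 148): «THE BILINEAR EXTENSION TO V ⊗_F W …
STAY[S] PROSE».  This seat's file 78 (`T5DeltaTwistSymplectic`, p398050) proved the identity on PURE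
tensors, with forms as functions.  Here the forms carry their (sesqui)linear structure and the
identity is proved on the whole tensor space, in the coordinate model:

* `V = ι → E`, `W = κ → E` with Gram matrices `M` (hermitian, `Mᴴ = M`) and `N` (skew-hermitian,
  `Nᴴ = -N`); `gram M x y = star x ⬝ᵥ (M *ᵥ y)` is the sesquilinear form of `M`;
* `V ⊗_E W = ι × κ → E`, the pure tensor `tmul x y = (i, k) ↦ x i * y k`, and the Gram matrix of the
  tensor form is the Kronecker product `M ⊗ₖ N`: **`gram_kronecker_tmul`** —
  `gram (M ⊗ₖ N) (tmul x y) (tmul x' y') = gram M x x' * gram N y y'` (so `gram (M ⊗ₖ N)` IS the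
  sesquilinear extension of `h ⊗ s` from pure tensors, uniquely since pure tensors span);
* **`kronecker_twist`**: `(δ⁻¹ • M) ⊗ₖ (δ • N) = M ⊗ₖ N` for `δ ≠ 0`, hence **`gram_twist`** /
  **`traceGram_twist`**: the twisted and the untwisted forms are the SAME function on all of
  `(ι × κ → E) × (ι × κ → E)` — the bilinear extension of file 78's `traceForm_twist`;
* `traceGram K z z' = trace (gram K z z')` (trace `z + star z`, file 78's `trace`) is bi-additive,
  homogeneous for star-fixed scalars (`F = E^{star}`), skew-symmetric and alternating on the whole
  space when `M` is hermitian and `N` skew-hermitian (`(M ⊗ₖ N)ᴴ = -(M ⊗ₖ N)`), and non-degenerate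
  when `M`, `N` are invertible and `2 ≠ 0` in `E` — the symplectic `F`-space
  `Res_{E/F}(V ⊗_E W, tr_{E/F}(h ⊗ s))` of Kudla's setting, in coordinates.

What stays prose: that the datum's `W₁₂,v`, `V_v` are these Gram matrices over the completion `E_v`
(p4's column), and Kudla's splitting itself (formed with the same `(χ, ψ)`).
-/

namespace Summit.Ventures.HodgeRepro2.T5DeltaTwistTensor

open scoped Matrix Kronecker
open Summit.Ventures.HodgeRepro2.T5DeltaTwistSymplectic (IsHermitianFn IsSkewHermitianFn traceForm)

variable {E : Type*} [Field E] [StarRing E]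
variable {ι κ : Type*} [Fintype ι] [Fintype κ]

section gram

/-- The sesquilinear form of a square matrix `M`: `gram M x y = star x ⬝ᵥ (M *ᵥ y)`
(conjugate-linear in `x`, linear in `y`). -/
def gram (M : Matrix ι ι E) (x y : ι → E) : E := star x ⬝ᵥ (M *ᵥ y)

/-- Unfolding lemma for `gram`. -/
theorem gram_apply (M : Matrix ι ι E) (x y : ι → E) : gram M x y = star x ⬝ᵥ (M *ᵥ y) := rfl

/-- `gram M x y = ∑ i, ∑ j, star (x i) * (M i j * y j)`. -/
theorem gram_eq_sum (M : Matrix ι ι E) (x y : ι → E) :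
    gram M x y = ∑ i, ∑ j, star (x i) * (M i j * y j) := by
  simp only [gram, dotProduct, Matrix.mulVec, Pi.star_apply, Finset.mul_sum]

/-- `gram M` is additive in the first slot. -/
theorem gram_add_left (M : Matrix ι ι E) (x x' y : ι → E) :
    gram M (x + x') y = gram M x y + gram M x' y := by
  simp only [gram, star_add, add_dotProduct]

/-- `gram M` is additive in the second slot. -/
theorem gram_add_right (M : Matrix ι ι E) (x y y' : ι → E) :
    gram M x (y + y') = gram M x y + gram M x y' := by
  simp only [gram, Matrix.mulVec_add, dotProduct_add]

/-- `gram M` is conjugate-linear in the first slot: `gram M (c • x) y = star c * gram M x y`. -/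
theorem gram_smul_left (M : Matrix ι ι E) (c : E) (x y : ι → E) :
    gram M (c • x) y = star c * gram M x y := by
  simp only [gram, star_smul, smul_dotProduct, smul_eq_mul]

/-- `gram M` is linear in the second slot: `gram M x (c • y) = c * gram M x y`. -/
theorem gram_smul_right (M : Matrix ι ι E) (c : E) (x y : ι → E) :
    gram M x (c • y) = c * gram M x y := by
  simp only [gram, Matrix.mulVec_smul, dotProduct_smul, smul_eq_mul]

/-- `star (gram M y x) = gram Mᴴ x y`. -/
theorem star_gram (M : Matrix ι ι E) (x y : ι → E) : star (gram M y x) = gram Mᴴ x y := by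
  simp only [gram]
  rw [← Matrix.star_dotProduct, Matrix.star_mulVec, ← Matrix.dotProduct_mulVec]

/-- A hermitian Gram matrix gives a hermitian form (file 78's `IsHermitianFn`). -/
theorem isHermitianFn_gram {M : Matrix ι ι E} (hM : Mᴴ = M) : IsHermitianFn (gram M) := by
  intro x y
  rw [star_gram, hM]

/-- A skew-hermitian Gram matrix gives a skew-hermitian form (file 78's `IsSkewHermitianFn`). -/
theorem isSkewHermitianFn_gram {N : Matrix ι ι E} (hN : Nᴴ = -N) :
    IsSkewHermitianFn (gram N) := by
  intro x y
  rw [star_gram, hN]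
  simp only [gram, Matrix.neg_mulVec, dotProduct_neg, neg_neg]

end gram

section tensor

/-- The pure tensor `x ⊗ y` in the coordinate model `V ⊗_E W = ι × κ → E`. -/
def tmul (x : ι → E) (y : κ → E) : ι × κ → E := fun p => x p.1 * y p.2

omit [StarRing E] [Fintype ι] [Fintype κ] in
/-- Unfolding lemma for the pure tensor `tmul`. -/
theorem tmul_apply (x : ι → E) (y : κ → E) (i : ι) (k : κ) : tmul x y (i, k) = x i * y k := rfl

/-- **The Kronecker Gram matrix is the tensor form on pure tensors**:
`gram (M ⊗ₖ N) (x ⊗ y) (x' ⊗ y') = gram M x x' * gram N y y'`. -/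
theorem gram_kronecker_tmul (M : Matrix ι ι E) (N : Matrix κ κ E) (x x' : ι → E) (y y' : κ → E) :
    gram (M ⊗ₖ N) (tmul x y) (tmul x' y') = gram M x x' * gram N y y' := by
  rw [gram_eq_sum, gram_eq_sum, gram_eq_sum, Finset.sum_mul_sum]
  simp only [Fintype.sum_prod_type, Matrix.kronecker_apply, tmul_apply]
  refine Finset.sum_congr rfl fun i _ => Finset.sum_congr rfl fun k _ => ?_
  rw [Finset.sum_mul_sum]
  refine Finset.sum_congr rfl fun j _ => Finset.sum_congr rfl fun l _ => ?_
  rw [star_mul']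
  ring

omit [StarRing E] [Fintype ι] [Fintype κ] in
/-- **The δ-twist on Gram matrices**: `(δ⁻¹ • M) ⊗ₖ (δ • N) = M ⊗ₖ N`. -/
theorem kronecker_twist (δ : E) (hδ : δ ≠ 0) (M : Matrix ι ι E) (N : Matrix κ κ E) :
    (δ⁻¹ • M) ⊗ₖ (δ • N) = M ⊗ₖ N := by
  rw [Matrix.smul_kronecker, Matrix.kronecker_smul, smul_smul, inv_mul_cancel₀ hδ, one_smul]

/-- **The bilinear extension of the δ-twist identity**: the sesquilinear forms of
`(δ⁻¹ • M) ⊗ₖ (δ • N)` and of `M ⊗ₖ N` agree on the WHOLE tensor space (file 78's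
`traceForm_twist` was the pure-tensor case, with forms as functions). -/
theorem gram_twist (δ : E) (hδ : δ ≠ 0) (M : Matrix ι ι E) (N : Matrix κ κ E) :
    gram ((δ⁻¹ • M) ⊗ₖ (δ • N)) = gram (M ⊗ₖ N) := by
  rw [kronecker_twist δ hδ]

/-- The twisted Gram forms on the factors are file 78's twisted functions
(`δ⁻¹ * gram M x y` and `δ * gram N y y'`). -/
theorem gram_smul (δ : E) (M : Matrix ι ι E) (x y : ι → E) :
    gram (δ • M) x y = δ * gram M x y := by
  simp only [gram, Matrix.smul_mulVec, dotProduct_smul, smul_eq_mul]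

omit [Fintype ι] [Fintype κ] in
/-- Hermitian ⊗ skew-hermitian is skew-hermitian: `(M ⊗ₖ N)ᴴ = -(M ⊗ₖ N)`. -/
theorem conjTranspose_kronecker_eq_neg {M : Matrix ι ι E} {N : Matrix κ κ E} (hM : Mᴴ = M)
    (hN : Nᴴ = -N) : (M ⊗ₖ N)ᴴ = -(M ⊗ₖ N) := by
  rw [Matrix.conjTranspose_kronecker, hM, hN]
  ext ⟨i, k⟩ ⟨j, l⟩
  simp only [Matrix.kronecker_apply, Matrix.neg_apply, mul_neg]

end tensor

section traceForm

/-- The `F`-valued (trace) form of the tensor Gram matrix `K` on `V ⊗_E W`: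
`traceGram K z z' = trace (gram K z z')`, `trace z = z + star z` (file 78). -/
def traceGram (K : Matrix (ι × κ) (ι × κ) E) (z z' : ι × κ → E) : E :=
  T5DeltaTwistSymplectic.trace (gram K z z')

/-- Unfolding lemma for `traceGram`: `traceGram K z z' = gram K z z' + star (gram K z z')`. -/
theorem traceGram_apply (K : Matrix (ι × κ) (ι × κ) E) (z z' : ι × κ → E) :
    traceGram K z z' = gram K z z' + star (gram K z z') := rfl

/-- On pure tensors the trace form of `M ⊗ₖ N` is file 78's `traceForm (gram M) (gram N)`. -/
theorem traceGram_kronecker_tmul (M : Matrix ι ι E) (N : Matrix κ κ E) (x x' : ι → E)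
    (y y' : κ → E) :
    traceGram (M ⊗ₖ N) (tmul x y) (tmul x' y') = traceForm (gram M) (gram N) (x, y) (x', y') := by
  simp only [traceGram, traceForm, gram_kronecker_tmul]

/-- **`traceGram_twist`** — the trace form of the twisted tensor datum is the trace form of the
untwisted one, on the whole space: `tr (δ⁻¹h ⊗ δs) = tr (h ⊗ s)`. -/
theorem traceGram_twist (δ : E) (hδ : δ ≠ 0) (M : Matrix ι ι E) (N : Matrix κ κ E) :
    traceGram ((δ⁻¹ • M) ⊗ₖ (δ • N)) = traceGram (M ⊗ₖ N) := by
  rw [kronecker_twist δ hδ]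

/-- `traceGram K` is additive in the first slot. -/
theorem traceGram_add_left (K : Matrix (ι × κ) (ι × κ) E) (z z₁ z' : ι × κ → E) :
    traceGram K (z + z₁) z' = traceGram K z z' + traceGram K z₁ z' := by
  simp only [traceGram, gram_add_left, T5DeltaTwistSymplectic.trace_add]

/-- `traceGram K` is additive in the second slot. -/
theorem traceGram_add_right (K : Matrix (ι × κ) (ι × κ) E) (z z' z₁' : ι × κ → E) :
    traceGram K z (z' + z₁') = traceGram K z z' + traceGram K z z₁' := by
  simp only [traceGram, gram_add_right, T5DeltaTwistSymplectic.trace_add]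

/-- `F`-homogeneity in the first slot, `F = E^{star}` (`star c = c`). -/
theorem traceGram_smul_left (K : Matrix (ι × κ) (ι × κ) E) {c : E} (hc : star c = c)
    (z z' : ι × κ → E) : traceGram K (c • z) z' = c * traceGram K z z' := by
  simp only [traceGram, T5DeltaTwistSymplectic.trace, gram_smul_left, star_mul', hc, mul_add]

/-- `F`-homogeneity in the second slot, `F = E^{star}` (`star c = c`). -/
theorem traceGram_smul_right (K : Matrix (ι × κ) (ι × κ) E) {c : E} (hc : star c = c)
    (z z' : ι × κ → E) : traceGram K z (c • z') = c * traceGram K z z' := by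
  simp only [traceGram, T5DeltaTwistSymplectic.trace, gram_smul_right, star_mul', hc, mul_add]

/-- **Skew-symmetry on the whole space**: for `M` hermitian and `N` skew-hermitian,
`traceGram (M ⊗ₖ N) z' z = -traceGram (M ⊗ₖ N) z z'` (file 78's `traceForm_swap` was the
pure-tensor case). -/
theorem traceGram_swap {M : Matrix ι ι E} {N : Matrix κ κ E} (hM : Mᴴ = M) (hN : Nᴴ = -N)
    (z z' : ι × κ → E) : traceGram (M ⊗ₖ N) z' z = -traceGram (M ⊗ₖ N) z z' := by
  have hK := isSkewHermitianFn_gram (conjTranspose_kronecker_eq_neg hM hN)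
  simp only [traceGram, T5DeltaTwistSymplectic.trace]
  rw [hK z' z, star_neg, star_star]
  ring

/-- **Alternating on the whole space**: `traceGram (M ⊗ₖ N) z z = 0` (file 78's `traceForm_self`
was the pure-tensor case). -/
theorem traceGram_self {M : Matrix ι ι E} {N : Matrix κ κ E} (hM : Mᴴ = M) (hN : Nᴴ = -N)
    (z : ι × κ → E) : traceGram (M ⊗ₖ N) z z = 0 := by
  have h := traceGram_swap hM hN z z
  have h2 : (2 : E) * traceGram (M ⊗ₖ N) z z = 0 := by linear_combination h
  rcases eq_or_ne (2 : E) 0 with h2z | h2z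
  · -- characteristic 2: `trace` of a `star`-anti-fixed element vanishes outright
    have hK := isSkewHermitianFn_gram (conjTranspose_kronecker_eq_neg hM hN)
    simp only [traceGram]
    exact T5DeltaTwistSymplectic.trace_eq_zero_of_star_eq_neg (by linear_combination hK z z)
  · exact (mul_eq_zero.mp h2).resolve_left h2z

/-- **Non-degeneracy** (`2 ≠ 0` in `E`): if `traceGram K z z' = 0` for every `z'` and `K` is
invertible (e.g. `K = M ⊗ₖ N` with `det M ≠ 0 ≠ det N`, `Matrix.det_kronecker`), then `z = 0`. -/
theorem eq_zero_of_traceGram_eq_zero [DecidableEq ι] [DecidableEq κ]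
    {K : Matrix (ι × κ) (ι × κ) E} (hK : IsUnit K) (h2 : (2 : E) ≠ 0) {z : ι × κ → E}
    (hz : ∀ z', traceGram K z z' = 0) : z = 0 := by
  -- first the `E`-valued form vanishes: `gram K z z' = 0` for all `z'`
  have hg : ∀ z', gram K z z' = 0 := by
    intro z'
    by_contra hne
    -- test against `z'' := star (gram K z z') • z'`: `trace (a * star a) = 2 * a * star a ≠ 0`
    have h1 := hz (star (gram K z z') • z')
    rw [traceGram_apply, gram_smul_right, star_mul', star_star] at h1
    have : (2 : E) * (gram K z z' * star (gram K z z')) = 0 := by linear_combination h1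
    rcases mul_eq_zero.mp this with h | h
    · exact h2 h
    · rcases mul_eq_zero.mp h with h | h
      · exact hne h
      · exact hne (star_eq_zero.mp h)
  -- hence `star z ᵥ* K = 0`, and `K` is invertible
  have hv : star z ᵥ* K = 0 := by
    rw [← dotProduct_eq_zero_iff]
    intro w
    rw [← Matrix.dotProduct_mulVec]
    exact hg w
  have hinj := Matrix.vecMul_injective_of_isUnit hK
  have hz0 : star z = 0 := hinj (by simpa using hv)
  simpa using congrArg star hz0

omit [StarRing E] in
/-- `M ⊗ₖ N` is invertible when `M` and `N` are (`Matrix.det_kronecker`). -/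
theorem isUnit_kronecker [DecidableEq ι] [DecidableEq κ] {M : Matrix ι ι E} {N : Matrix κ κ E}
    (hM : IsUnit M.det) (hN : IsUnit N.det) : IsUnit (M ⊗ₖ N) := by
  rw [Matrix.isUnit_iff_isUnit_det, Matrix.det_kronecker]
  exact (hM.pow _).mul (hN.pow _)

end traceForm

end Summit.Ventures.HodgeRepro2.T5DeltaTwistTensor
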